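import Literature.MathematicalPhysics.QuantumLattice.FermionOperatorsProofs
import Literature.MathematicalPhysics.QuantumLattice.HubbardGaugeBound
import Literature.MathematicalPhysics.QuantumLattice.TraceInequalitiesProofs
import Literature.MathematicalPhysics.QuantumLattice.DuhamelTwoPoint
import HarnessLib

/-!
# Log-Lipschitz continuity of particle-number sector weights of a fermionic Gibbs state (orbit-sum transfer)

Topic `MathematicalPhysics/QuantumLattice` (matrix analysis behind the finite-volume equivalence-of-ensembles
estimates; consumer: the thermal wedge of the Hubbard summit). For a Hermitian `K` on the fermionic Fock space
over a finite orbital set `ι` which conserves the particle number and has bounded commutators with the single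
fermion operators, `‖[K, c_o]‖, ‖[K, c†_o]‖ ≤ r`, the particle-number SECTOR WEIGHTS of the Gibbs weight
`e^{−βK}`, `W(N) = Σ_{|s| = N} Re (e^{−βK})_{ss} = Re tr (P_N e^{−βK})`, are log-Lipschitz in `N` at `β ≥ 0`:

`(|ι| − N) W(N) ≤ e^{β|ι|r/(|ι|−N)} (N+1) W(N+1)`,  `(N+1) W(N+1) ≤ e^{β|ι|r/(N+1)} (|ι| − N) W(N)`

(`sectorWeight_orbitSum_transfer`) — the finite-temperature form of the orbit-sum (trial-state averaging)
argument for the continuity of canonical quantities in the density (Ruelle 1969, §3.4; Bratteli–Robinson II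
§5.2–5.3 for the CAR algebra and Gibbs states in the Jordan–Wigner representation). Everything is PROVED; no
definition and no named fact.

* `orbitSum_transfer_gibbsWeight` (pure matrix analysis): for a Hermitian `K`, an orthogonal projection `P`
  commuting with `K`, trial maps `T_o` with `(Σ_o T_oᴴ T_o) P = a P` (`a > 0`) and
  `Re ⟨Pv, (Σ_o T_oᴴ[K, T_o]) Pv⟩ ≤ ρ ‖Pv‖²`, one has
  `a · Re tr(P e^{−βK}) ≤ e^{βρ/a} · Re tr((Σ_o T_o P T_oᴴ) e^{−βK})`. In an eigenbasis `K u_i = E_i u_i`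
  (`Matrix.IsHermitian.eigenvectorUnitary`, `Matrix.IsHermitian.gibbsWeight_eq`) the vectors `T_o P u_i` have
  total weight `a ‖Pu_i‖²` and total energy `≤ (ρ + a E_i)‖P u_i‖²`; Jensen for their spectral weights
  (convexity of `exp`, `mass_mul_exp_le_sum_sum_mul_exp`) gives
  `Σ_o Re⟨T_oPu_i, e^{−βK} T_oPu_i⟩ ≥ a‖Pu_i‖² e^{−βE_i} e^{−βρ/a}`, and the sum over `i` is the frame identity
  `Σ_i |u_i⟩⟨u_i| = 1` (Peierls–Jensen, as in `Matrix.peierls_bogoliubov`).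
* CAR bookkeeping with the particle-number projections `P_N = diagonal (1_{|s| = N})` (written out, no
  definition): `(Σ_o c_o c†_o) P_N = (|ι| − N) P_N`, `Σ_o c†_o P_N c_o = (N+1) P_{N+1}`,
  `(Σ_o c†_o c_o) P_{N+1} = (N+1) P_{N+1}`, `Σ_o c_o P_{N+1} c†_o = (|ι| − N) P_N`, `Σ_{|s|=N} Re G_{ss} = Re tr (P_N G)`.
* `sectorWeight_orbitSum_transfer`: the two inequalities above (`orbitSum_transfer_gibbsWeight` with
  `T_o = c†_o`, resp. `c_o`, and `ρ = |ι| r`). The statement is parametric in the `DecidableEq ι` instance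
  (on which the `ℓ²` operator norm and `Matrix.gibbsWeight` depend syntactically); the proof substitutes
  `LinearOrder.toDecidableEq`.

## References
* D. Ruelle, *Statistical Mechanics: Rigorous Results* (1969), §3.4 (thermodynamic limit for quantum lattice
  systems, continuity in the density). [cite: Ruelle1969, §3.4]
* O. Bratteli, D. W. Robinson, *Operator Algebras and Quantum Statistical Mechanics II* (1997), §5.2.2 (CAR
  algebra), §5.3.1 (Gibbs states). [cite: BratteliRobinsonII1997, §5.2.2]
-/

noncomputable section

open scoped Matrix.Norms.L2Operator ComplexOrder
open Matrix Finset

namespace Literature.MathematicalPhysics.QuantumLattice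

/-! ### Matrix analysis: the orbit-sum transfer inequality in an eigenbasis -/

section Transfer

variable {n : Type*} [Fintype n] [DecidableEq n]

/-- Diagonal entries of `Bᴴ diag(d) B` for a real `d`: `(Bᴴ diag(d) B)_{ii} = Σ_k ‖B_{ki}‖² d_k`. [folklore] -/
theorem conjTranspose_mul_realDiagonal_mul_apply_self (B : Matrix n n ℂ) (d : n → ℝ) (i : n) :
    (Bᴴ * diagonal (fun k => (d k : ℂ)) * B) i i = ((∑ k, ‖B k i‖ ^ 2 * d k : ℝ) : ℂ) := by
  have h := Matrix.conj_diagonal_apply_self Bᴴ d i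
  rw [star_eq_conjTranspose, conjTranspose_conjTranspose] at h
  rw [h]
  simp only [conjTranspose_apply, norm_star]

omit [DecidableEq n] in
/-- `(U⋆ X U)_{ii} = ⟨u_i, X u_i⟩` with `u_i` the `i`-th column of `U`. [folklore] -/
theorem star_mul_mul_apply_self_eq_star_dotProduct_mulVec (U X : Matrix n n ℂ) (i : n) :
    (star U * X * U) i i = star (fun s => U s i) ⬝ᵥ (X *ᵥ fun s => U s i) := by
  calc (star U * X * U) i i = ∑ s, ∑ t, star (U t i) * X t s * U s i := by
        simp only [mul_apply, star_apply, Finset.sum_mul]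
    _ = ∑ t, ∑ s, star (U t i) * X t s * U s i := Finset.sum_comm
    _ = star (fun s => U s i) ⬝ᵥ (X *ᵥ fun s => U s i) := by
        simp only [dotProduct, mulVec, Pi.star_apply, Finset.mul_sum]
        refine Finset.sum_congr rfl fun t _ => Finset.sum_congr rfl fun s _ => ?_
        ring

/-- **Scalar Jensen step.** For nonnegative weights `w_{ok}` of total mass `S` and levels `x_k` with
`Σ w x ≤ c S + S E` and `β ≥ 0`: `S e^{−βc} e^{−βE} ≤ Σ_{o,k} w_{ok} e^{−β x_k}` (convexity of `exp`). [folklore] -/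
theorem mass_mul_exp_le_sum_sum_mul_exp {O κ : Type*} [Fintype O] [Fintype κ] (w : O → κ → ℝ) (x : κ → ℝ)
    (hw : ∀ o k, 0 ≤ w o k) {S c E β : ℝ} (hS : ∑ o, ∑ k, w o k = S) (hβ : 0 ≤ β)
    (hM : ∑ o, ∑ k, w o k * x k ≤ c * S + S * E) :
    S * Real.exp (-(β * c)) * Real.exp (-(β * E)) ≤ ∑ o, ∑ k, w o k * Real.exp (-(β * x k)) := by
  have hS' : ∑ p : O × κ, w p.1 p.2 = S := by rw [Fintype.sum_prod_type]; exact hS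
  have hS0 : 0 ≤ S := hS' ▸ Finset.sum_nonneg fun p _ => hw p.1 p.2
  rcases hS0.eq_or_lt with h0 | hpos
  · rw [← h0, zero_mul, zero_mul]
    exact Finset.sum_nonneg fun o _ => Finset.sum_nonneg fun k _ =>
      mul_nonneg (hw o k) (Real.exp_pos _).le
  · have hJ := (convexOn_exp).map_centerMass_le (t := (Finset.univ : Finset (O × κ)))
      (w := fun p => w p.1 p.2) (p := fun p => -(β * x p.2)) (fun p _ => hw p.1 p.2)
      (by rw [hS']; exact hpos) (fun p _ => Set.mem_univ _)
    simp only [Finset.centerMass, hS', smul_eq_mul, Function.comp_def] at hJ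
    rw [Fintype.sum_prod_type, Fintype.sum_prod_type] at hJ
    -- `hJ : exp (S⁻¹ Σ w (−βx)) ≤ S⁻¹ Σ w e^{−βx}`
    have hsum : ∑ o, ∑ k, w o k * -(β * x k) = -(β * ∑ o, ∑ k, w o k * x k) := by
      rw [Finset.mul_sum, ← Finset.sum_neg_distrib]
      refine Finset.sum_congr rfl fun o _ => ?_
      rw [Finset.mul_sum, ← Finset.sum_neg_distrib]
      exact Finset.sum_congr rfl fun k _ => by ring
    rw [hsum] at hJ
    have hlow : -(β * c) + -(β * E) ≤ S⁻¹ * -(β * ∑ o, ∑ k, w o k * x k) := by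
      have h1 : β * ∑ o, ∑ k, w o k * x k ≤ β * (c * S + S * E) := mul_le_mul_of_nonneg_left hM hβ
      rw [show S⁻¹ * -(β * ∑ o, ∑ k, w o k * x k) = -(β * ∑ o, ∑ k, w o k * x k) / S by ring,
        le_div_iff₀ hpos]
      nlinarith
    calc S * Real.exp (-(β * c)) * Real.exp (-(β * E))
        = S * Real.exp (-(β * c) + -(β * E)) := by rw [Real.exp_add]; ring
      _ ≤ S * Real.exp (S⁻¹ * -(β * ∑ o, ∑ k, w o k * x k)) :=
          mul_le_mul_of_nonneg_left (Real.exp_le_exp.2 hlow) hpos.le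
      _ ≤ S * (S⁻¹ * ∑ o, ∑ k, w o k * Real.exp (-(β * x k))) :=
          mul_le_mul_of_nonneg_left hJ hpos.le
      _ = ∑ o, ∑ k, w o k * Real.exp (-(β * x k)) := by
          rw [← mul_assoc, mul_inv_cancel₀ hpos.ne', one_mul]

/-- **Rayleigh bound for an orbit sum of commutators**: if `‖T_o‖ ≤ 1` and `‖[K, T_o]‖ ≤ r` for all `o`,
then `Re ⟨w, Σ_o T_oᴴ [K, T_o] w⟩ ≤ |O| r ‖w‖²` (Cauchy–Schwarz with the `ℓ²` operator norm). [folklore] -/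
theorem re_star_dotProduct_sum_commutator_mulVec_le {O : Type*} [Fintype O] (K : Matrix n n ℂ)
    (T : O → Matrix n n ℂ) {r : ℝ} (hT : ∀ o, ‖T o‖ ≤ 1) (hc : ∀ o, ‖K * T o - T o * K‖ ≤ r)
    (w : n → ℂ) :
    (star w ⬝ᵥ ((∑ o, (T o)ᴴ * (K * T o - T o * K)) *ᵥ w)).re ≤
      Fintype.card O * r * (star w ⬝ᵥ w).re := by
  rw [Matrix.sum_mulVec, dotProduct_sum, Complex.re_sum]
  have hw0 : 0 ≤ (star w ⬝ᵥ w).re := (Complex.nonneg_iff.mp (dotProduct_star_self_nonneg w)).1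
  calc ∑ o, (star w ⬝ᵥ (((T o)ᴴ * (K * T o - T o * K)) *ᵥ w)).re
      ≤ ∑ _o : O, r * (star w ⬝ᵥ w).re := by
        refine Finset.sum_le_sum fun o _ => ?_
        calc (star w ⬝ᵥ (((T o)ᴴ * (K * T o - T o * K)) *ᵥ w)).re
            ≤ ‖star w ⬝ᵥ (((T o)ᴴ * (K * T o - T o * K)) *ᵥ w)‖ := Complex.re_le_norm _
          _ ≤ ‖(T o)ᴴ * (K * T o - T o * K)‖ * (star w ⬝ᵥ w).re :=
              Literature.MathematicalPhysics.QuantumLattice.norm_star_dotProduct_mulVec_le _ _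
          _ ≤ 1 * r * (star w ⬝ᵥ w).re := by
              refine mul_le_mul_of_nonneg_right ?_ hw0
              calc ‖(T o)ᴴ * (K * T o - T o * K)‖ ≤ ‖(T o)ᴴ‖ * ‖K * T o - T o * K‖ :=
                    Matrix.l2_opNorm_mul _ _
                _ ≤ 1 * r := mul_le_mul ((Matrix.l2_opNorm_conjTranspose _).le.trans (hT o)) (hc o)
                    (norm_nonneg _) zero_le_one
          _ = r * (star w ⬝ᵥ w).re := by rw [one_mul]
    _ = Fintype.card O * r * (star w ⬝ᵥ w).re := by
        rw [Finset.sum_const, Finset.card_univ, nsmul_eq_mul]; ring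

/-- **The orbit-sum transfer inequality.** `K` Hermitian, `P` an orthogonal projection commuting with `K`,
trial maps `T_o` with `(Σ_o T_oᴴ T_o) P = a P`, `a > 0`, and `Re ⟨Pv, (Σ_o T_oᴴ [K, T_o]) Pv⟩ ≤ ρ ‖Pv‖²`;
then for `β ≥ 0`, `a · Re tr (P e^{−βK}) ≤ e^{βρ/a} · Re tr ((Σ_o T_o P T_oᴴ) e^{−βK})` (per-eigenvector
Jensen for the spectral weights of the trial vectors, summed with the frame identity). [folklore] -/
theorem orbitSum_transfer_gibbsWeight {O : Type*} [Fintype O] {K P : Matrix n n ℂ} (hK : K.IsHermitian)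
    (hPh : Pᴴ = P) (hPP : P * P = P) (hPK : P * K = K * P) (T : O → Matrix n n ℂ)
    {a ρ β : ℝ} (ha : 0 < a) (hβ : 0 ≤ β)
    (hw : (∑ o, (T o)ᴴ * T o) * P = (a : ℂ) • P)
    (hR : ∀ v : n → ℂ, (star (P *ᵥ v) ⬝ᵥ ((∑ o, (T o)ᴴ * (K * T o - T o * K)) *ᵥ (P *ᵥ v))).re ≤
      ρ * (star (P *ᵥ v) ⬝ᵥ (P *ᵥ v)).re) :
    a * ((P * gibbsWeight β K).trace).re ≤
      Real.exp (β * ρ / a) * (((∑ o, T o * P * (T o)ᴴ) * gibbsWeight β K).trace).re := by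
  -- the eigenbasis of `K`
  set U : Matrix n n ℂ := (hK.eigenvectorUnitary : Matrix n n ℂ) with hU
  have hUu : U ∈ unitary (Matrix n n ℂ) := hK.eigenvectorUnitary.prop
  have hUU : U * star U = 1 := Unitary.mul_star_self_of_mem hUu
  have hU'U : star U * U = 1 := Unitary.star_mul_self_of_mem hUu
  set E : n → ℝ := hK.eigenvalues with hE
  have hG : gibbsWeight β K = U * diagonal (fun k => (Real.exp (-(β * E k)) : ℂ)) * star U :=
    hK.gibbsWeight_eq β
  have hKd : K = U * diagonal (fun k => (E k : ℂ)) * star U := hK.eq_conj_diagonal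
  have hKU : K * U = U * diagonal (fun k => (E k : ℂ)) := by
    conv_lhs => rw [hKd]
    rw [Matrix.mul_assoc, hU'U, Matrix.mul_one]
  -- rewrite rules in right-associated normal form
  have hw' : ∀ X : Matrix n n ℂ, (∑ o, (T o)ᴴ * T o) * (P * X) = (a : ℂ) • (P * X) := fun X => by
    rw [← Matrix.mul_assoc, hw, Matrix.smul_mul]
  have hPP' : ∀ X : Matrix n n ℂ, P * (P * X) = P * X := fun X => by
    rw [← Matrix.mul_assoc, hPP]
  have hadj : ∀ u w : n → ℂ, star u ⬝ᵥ (P *ᵥ w) = star (P *ᵥ u) ⬝ᵥ w := fun u w => by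
    rw [star_mulVec, hPh, dotProduct_mulVec]
  -- the sandwich identity `B_oᴴ diag(d) B_o = U⋆ (P T_oᴴ (U diag(d) U⋆) T_o P) U`, `B_o = U⋆ T_o P U`
  have hsand : ∀ (o : O) (d : n → ℝ),
      (star U * (T o * P) * U)ᴴ * diagonal (fun k => (d k : ℂ)) * (star U * (T o * P) * U) =
        star U * (P * ((T o)ᴴ * (U * diagonal (fun k => (d k : ℂ)) * star U) * T o) * P) * U := by
    intro o d
    rw [conjTranspose_mul, conjTranspose_mul, conjTranspose_mul, hPh, star_eq_conjTranspose,
      conjTranspose_conjTranspose]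
    simp only [Matrix.mul_assoc]
  have hentry : ∀ (o : O) (d : n → ℝ) (i : n),
      ((∑ k, ‖(star U * (T o * P) * U) k i‖ ^ 2 * d k : ℝ) : ℂ) =
        (star U * (P * ((T o)ᴴ * (U * diagonal (fun k => (d k : ℂ)) * star U) * T o) * P) * U) i i := by
    intro o d i
    rw [← conjTranspose_mul_realDiagonal_mul_apply_self, hsand]
  have hsumo : ∀ F : Matrix n n ℂ, ∑ o, star U * (P * ((T o)ᴴ * F * T o) * P) * U =
      star U * (P * (∑ o, (T o)ᴴ * F * T o) * P) * U := by
    intro F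
    rw [Finset.mul_sum, Finset.sum_mul, Finset.mul_sum, Finset.sum_mul]
  -- (1) total mass of the weights `ω_i(o,k) = ‖(U⋆ T_o P U)_{ki}‖²`
  have hS : ∀ i, ∑ o, ∑ k, ‖(star U * (T o * P) * U) k i‖ ^ 2 = a * ((star U * P * U) i i).re := by
    intro i
    have h : ((∑ o, ∑ k, ‖(star U * (T o * P) * U) k i‖ ^ 2 : ℝ) : ℂ) = (a : ℂ) * (star U * P * U) i i := by
      rw [Complex.ofReal_sum]
      have h1 : ∀ o, ((∑ k, ‖(star U * (T o * P) * U) k i‖ ^ 2 : ℝ) : ℂ) =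
          (star U * (P * ((T o)ᴴ * (1 : Matrix n n ℂ) * T o) * P) * U) i i := by
        intro o
        have h2 := hentry o (fun _ => (1 : ℝ)) i
        simp only [mul_one, Complex.ofReal_one, diagonal_one] at h2
        rw [h2, hUU]
      rw [Finset.sum_congr rfl fun o _ => h1 o, ← Matrix.sum_apply, hsumo]
      simp only [Matrix.mul_one]
      rw [Matrix.mul_assoc P, hw, Matrix.mul_smul, hPP, Matrix.mul_smul, Matrix.smul_mul, Matrix.smul_apply,
        smul_eq_mul]
    have := congrArg Complex.re h
    rwa [Complex.ofReal_re, Complex.re_ofReal_mul] at this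
  -- (2) the energy moment
  have hM : ∀ i, ∑ o, ∑ k, ‖(star U * (T o * P) * U) k i‖ ^ 2 * E k ≤
      ρ * ((star U * P * U) i i).re + a * ((star U * P * U) i i).re * E i := by
    intro i
    set R : Matrix n n ℂ := ∑ o, (T o)ᴴ * (K * T o - T o * K) with hRdef
    have hsplit : ∑ o, (T o)ᴴ * K * T o = R + (∑ o, (T o)ᴴ * T o) * K := by
      rw [hRdef, Finset.sum_mul, ← Finset.sum_add_distrib]
      refine Finset.sum_congr rfl fun o _ => ?_
      rw [Matrix.mul_sub, Matrix.mul_assoc, Matrix.mul_assoc, sub_add_cancel]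
    have hblock : P * (∑ o, (T o)ᴴ * K * T o) * P = P * R * P + (a : ℂ) • (P * K) := by
      rw [hsplit, Matrix.mul_add, Matrix.add_mul]
      congr 1
      rw [Matrix.mul_assoc, Matrix.mul_assoc, ← hPK, hw', Matrix.mul_smul, hPP']
    have h : ((∑ o, ∑ k, ‖(star U * (T o * P) * U) k i‖ ^ 2 * E k : ℝ) : ℂ) =
        star (P *ᵥ fun s => U s i) ⬝ᵥ (R *ᵥ (P *ᵥ fun s => U s i)) +
          (a : ℂ) * ((star U * P * U) i i * (E i : ℂ)) := by
      rw [Complex.ofReal_sum, Finset.sum_congr rfl fun o _ => hentry o E i, ← hKd, ← Matrix.sum_apply,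
        hsumo, hblock, Matrix.mul_add, Matrix.add_mul, Matrix.add_apply]
      congr 1
      · rw [star_mul_mul_apply_self_eq_star_dotProduct_mulVec, ← mulVec_mulVec, ← mulVec_mulVec, hadj]
      · rw [Matrix.mul_smul, Matrix.smul_mul, Matrix.smul_apply, smul_eq_mul]
        congr 1
        rw [show star U * (P * K) * U = star U * P * U * diagonal (fun k => (E k : ℂ)) by
          simp only [Matrix.mul_assoc, hKU], mul_diagonal]
    have hre := congrArg Complex.re h
    rw [Complex.ofReal_re, Complex.add_re, Complex.re_ofReal_mul, Complex.re_mul_ofReal] at hre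
    rw [hre]
    have hα : (star (P *ᵥ fun s => U s i) ⬝ᵥ (P *ᵥ fun s => U s i)).re = ((star U * P * U) i i).re := by
      rw [star_mul_mul_apply_self_eq_star_dotProduct_mulVec, ← hadj, mulVec_mulVec, hPP]
    have h1 := hR (fun s => U s i)
    rw [hα] at h1
    linarith
  -- (3) Jensen, level by level
  have hkey : ∀ i, a * ((star U * P * U) i i).re * Real.exp (-(β * E i)) ≤
      Real.exp (β * ρ / a) * ∑ o, ∑ k, ‖(star U * (T o * P) * U) k i‖ ^ 2 * Real.exp (-(β * E k)) := by
    intro i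
    have hM' : ∑ o, ∑ k, ‖(star U * (T o * P) * U) k i‖ ^ 2 * E k ≤
        ρ / a * (a * ((star U * P * U) i i).re) + a * ((star U * P * U) i i).re * E i := by
      have hid : ρ / a * (a * ((star U * P * U) i i).re) = ρ * ((star U * P * U) i i).re := by
        rw [div_mul_eq_mul_div, mul_div_assoc, mul_div_cancel_left₀ _ ha.ne']
      rw [hid]
      exact hM i
    have hJ := mass_mul_exp_le_sum_sum_mul_exp (fun o k => ‖(star U * (T o * P) * U) k i‖ ^ 2) E
      (fun o k => sq_nonneg _) (hS i) hβ hM'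
    have hee : Real.exp (β * ρ / a) * Real.exp (-(β * (ρ / a))) = 1 := by
      rw [← Real.exp_add, show β * ρ / a + -(β * (ρ / a)) = 0 by ring, Real.exp_zero]
    calc a * ((star U * P * U) i i).re * Real.exp (-(β * E i))
        = Real.exp (β * ρ / a) * Real.exp (-(β * (ρ / a))) *
            (a * ((star U * P * U) i i).re * Real.exp (-(β * E i))) := by rw [hee, one_mul]
      _ = Real.exp (β * ρ / a) *
            (a * ((star U * P * U) i i).re * Real.exp (-(β * (ρ / a))) * Real.exp (-(β * E i))) := by ring
      _ ≤ _ := mul_le_mul_of_nonneg_left hJ (Real.exp_pos _).le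
  -- (4) the two traces in the eigenbasis
  have hL : ((P * gibbsWeight β K).trace).re = ∑ i, Real.exp (-(β * E i)) * ((star U * P * U) i i).re := by
    rw [trace_mul_comm, hG, Matrix.trace_unitary_conj_mul, Matrix.trace]
    simp only [Matrix.diag_apply, diagonal_mul, Complex.re_sum, Complex.re_ofReal_mul]
  have hRHS : (((∑ o, T o * P * (T o)ᴴ) * gibbsWeight β K).trace).re =
      ∑ i, ∑ o, ∑ k, ‖(star U * (T o * P) * U) k i‖ ^ 2 * Real.exp (-(β * E k)) := by
    have h1 : ∀ o, (T o * P * (T o)ᴴ * gibbsWeight β K).trace =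
        (P * ((T o)ᴴ * gibbsWeight β K * T o) * P).trace := by
      intro o
      calc (T o * P * (T o)ᴴ * gibbsWeight β K).trace
          = ((T o * P) * (P * ((T o)ᴴ * gibbsWeight β K))).trace := by
            simp only [Matrix.mul_assoc, hPP']
        _ = ((P * ((T o)ᴴ * gibbsWeight β K)) * (T o * P)).trace := Matrix.trace_mul_comm _ _
        _ = (P * ((T o)ᴴ * gibbsWeight β K * T o) * P).trace := by simp only [Matrix.mul_assoc]
    have h2 : ((∑ o, T o * P * (T o)ᴴ) * gibbsWeight β K).trace =
        (star U * (P * (∑ o, (T o)ᴴ * gibbsWeight β K * T o) * P) * U).trace := by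
      rw [Matrix.trace_mul_cycle (star U), hUU, Matrix.one_mul, Finset.sum_mul, Matrix.trace_sum,
        Finset.mul_sum, Finset.sum_mul, Matrix.trace_sum]
      exact Finset.sum_congr rfl fun o _ => h1 o
    have h3 : ∀ i, ((∑ o, ∑ k, ‖(star U * (T o * P) * U) k i‖ ^ 2 * Real.exp (-(β * E k)) : ℝ) : ℂ) =
        (star U * (P * (∑ o, (T o)ᴴ * gibbsWeight β K * T o) * P) * U) i i := by
      intro i
      rw [Complex.ofReal_sum, Finset.sum_congr rfl fun o _ => hentry o (fun k => Real.exp (-(β * E k))) i,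
        ← hG, ← Matrix.sum_apply, hsumo]
    rw [h2, Matrix.trace]
    simp only [Matrix.diag_apply]
    rw [← Finset.sum_congr rfl fun i _ => h3 i, ← Complex.ofReal_sum, Complex.ofReal_re]
  -- (5) assemble
  rw [hL, hRHS, Finset.mul_sum, Finset.mul_sum]
  refine Finset.sum_le_sum fun i _ => ?_
  calc a * (Real.exp (-(β * E i)) * ((star U * P * U) i i).re)
      = a * ((star U * P * U) i i).re * Real.exp (-(β * E i)) := by ring
    _ ≤ _ := hkey i

end Transfer

/-! ### CAR bookkeeping: particle-number projections, weight and frame identities -/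

section CAR

variable {ι : Type*} [LinearOrder ι] [Fintype ι]

omit [Fintype ι] in
/-- The particle-number projection `P_N = diag(1_{|s| = N})` is Hermitian. [folklore] -/
theorem numberProj_conjTranspose (N : ℕ) :
    (diagonal (fun s : Finset ι => if s.card = N then (1 : ℂ) else 0))ᴴ =
      diagonal (fun s : Finset ι => if s.card = N then (1 : ℂ) else 0) := by
  rw [diagonal_conjTranspose]
  congr 1
  funext s
  rw [Pi.star_apply]
  split_ifs <;> simp

/-- The particle-number projection `P_N` is idempotent. [folklore] -/
theorem numberProj_mul_self (N : ℕ) :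
    diagonal (fun s : Finset ι => if s.card = N then (1 : ℂ) else 0) *
        diagonal (fun s : Finset ι => if s.card = N then (1 : ℂ) else 0) =
      diagonal (fun s : Finset ι => if s.card = N then (1 : ℂ) else 0) := by
  rw [diagonal_mul_diagonal]
  congr 1
  funext s
  split_ifs <;> simp

/-- `P_N c_o = c_o P_{N+1}`: an annihilation operator lowers the particle number by one. [folklore] -/
theorem numberProj_mul_annihilation (N : ℕ) (o : ι) :
    diagonal (fun s : Finset ι => if s.card = N then (1 : ℂ) else 0) * annihilation o =
      annihilation o * diagonal (fun s : Finset ι => if s.card = N + 1 then (1 : ℂ) else 0) := by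
  ext s t
  rw [diagonal_mul, mul_diagonal, annihilation_apply]
  by_cases h : o ∉ s ∧ t = insert o s
  · have ht : t.card = s.card + 1 := by rw [h.2, Finset.card_insert_of_notMem h.1]
    rw [if_pos h]
    by_cases hs : s.card = N
    · rw [if_pos hs, if_pos (by omega), one_mul, mul_one]
    · rw [if_neg hs, if_neg (by omega), zero_mul, mul_zero]
  · rw [if_neg h, mul_zero, zero_mul]

/-- `P_{N+1} c†_o = c†_o P_N`: a creation operator raises the particle number by one. [folklore] -/
theorem numberProj_succ_mul_creation (N : ℕ) (o : ι) :
    diagonal (fun s : Finset ι => if s.card = N + 1 then (1 : ℂ) else 0) * creation o =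
      creation o * diagonal (fun s : Finset ι => if s.card = N then (1 : ℂ) else 0) := by
  have h := congrArg conjTranspose (numberProj_mul_annihilation (ι := ι) N o)
  simp only [conjTranspose_mul, numberProj_conjTranspose, annihilation_conjTranspose] at h
  exact h.symm

/-- A particle-number conserving matrix commutes with the particle-number projections. [folklore] -/
theorem numberProj_comm_of_card_eq (K : Matrix (Finset ι) (Finset ι) ℂ)
    (hK : ∀ s s' : Finset ι, K s s' ≠ 0 → s.card = s'.card) (M : ℕ) :
    diagonal (fun s : Finset ι => if s.card = M then (1 : ℂ) else 0) * K =
      K * diagonal (fun s : Finset ι => if s.card = M then (1 : ℂ) else 0) := by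
  ext s s'
  rw [diagonal_mul, mul_diagonal]
  by_cases h : K s s' = 0
  · rw [h, mul_zero, zero_mul]
  · rw [hK s s' h, mul_comm]

/-- `Σ_o c_o c†_o = |ι| − N̂` (CAR; `N̂ = diag(|s|)`, `totalNumberOp_eq_diagonal`). [folklore] -/
theorem sum_annihilation_mul_creation_eq_card_smul_one_sub :
    ∑ o : ι, annihilation o * creation o =
      (Fintype.card ι : ℂ) • (1 : Matrix (Finset ι) (Finset ι) ℂ) -
        diagonal (fun s : Finset ι => (s.card : ℂ)) := by
  have hCAR := annihilation_mul_creation_add_creation_mul_annihilation_holds (ι := ι)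
  have h1 : ∀ o : ι, annihilation o * creation o = 1 - creation o * annihilation o := fun o => by
    rw [eq_sub_iff_add_eq]
    have h := hCAR o o
    rwa [if_pos rfl] at h
  have h2 : ∑ o : ι, creation o * annihilation o = diagonal (fun s : Finset ι => (s.card : ℂ)) :=
    totalNumberOp_eq_diagonal (ι := ι)
  simp only [h1, Finset.sum_sub_distrib, Finset.sum_const, Finset.card_univ, h2]
  rw [← Nat.cast_smul_eq_nsmul ℂ]

/-- `N̂ P_N = N P_N`. [folklore] -/
theorem diagonal_card_mul_numberProj (N : ℕ) :
    diagonal (fun s : Finset ι => (s.card : ℂ)) * diagonal (fun s : Finset ι => if s.card = N then (1 : ℂ) else 0) =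
      (N : ℂ) • diagonal (fun s : Finset ι => if s.card = N then (1 : ℂ) else 0) := by
  rw [diagonal_mul_diagonal, ← diagonal_smul]
  congr 1
  funext s
  simp only [Pi.smul_apply, smul_eq_mul]
  split_ifs with h
  · rw [h]
  · simp

/-- **Weight identity for adding a particle**: `(Σ_o c_o c†_o) P_N = (|ι| − N) P_N`. [folklore] -/
theorem sum_creation_conjTranspose_mul_creation_mul_numberProj (N : ℕ) :
    (∑ o : ι, (creation o)ᴴ * creation o) * diagonal (fun s : Finset ι => if s.card = N then (1 : ℂ) else 0) =
      (((Fintype.card ι : ℝ) - N : ℝ) : ℂ) •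
        diagonal (fun s : Finset ι => if s.card = N then (1 : ℂ) else 0) := by
  simp only [creation_conjTranspose]
  rw [sum_annihilation_mul_creation_eq_card_smul_one_sub, Matrix.sub_mul, Matrix.smul_mul, Matrix.one_mul,
    diagonal_card_mul_numberProj, ← sub_smul]
  congr 1
  push_cast
  ring

/-- **Weight identity for removing a particle**: `(Σ_o c†_o c_o) P_{N+1} = (N+1) P_{N+1}`. [folklore] -/
theorem sum_annihilation_conjTranspose_mul_annihilation_mul_numberProj_succ (N : ℕ) :
    (∑ o : ι, (annihilation o)ᴴ * annihilation o) *
        diagonal (fun s : Finset ι => if s.card = N + 1 then (1 : ℂ) else 0) =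
      (((N : ℝ) + 1 : ℝ) : ℂ) • diagonal (fun s : Finset ι => if s.card = N + 1 then (1 : ℂ) else 0) := by
  simp only [annihilation_conjTranspose]
  rw [show ∑ o : ι, creation o * annihilation o = diagonal (fun s : Finset ι => (s.card : ℂ)) from
    totalNumberOp_eq_diagonal (ι := ι), diagonal_card_mul_numberProj]
  congr 1
  push_cast
  ring

/-- **Frame identity for adding a particle**: `Σ_o c†_o P_N c_o = (N+1) P_{N+1}`. [folklore] -/
theorem sum_creation_mul_numberProj_mul_conjTranspose (N : ℕ) :
    ∑ o : ι, creation o * diagonal (fun s : Finset ι => if s.card = N then (1 : ℂ) else 0) * (creation o)ᴴ =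
      (((N : ℝ) + 1 : ℝ) : ℂ) • diagonal (fun s : Finset ι => if s.card = N + 1 then (1 : ℂ) else 0) := by
  have h : ∀ o : ι, creation o * diagonal (fun s : Finset ι => if s.card = N then (1 : ℂ) else 0) * (creation o)ᴴ =
      creation o * annihilation o * diagonal (fun s : Finset ι => if s.card = N + 1 then (1 : ℂ) else 0) := by
    intro o
    rw [creation_conjTranspose, Matrix.mul_assoc, numberProj_mul_annihilation, ← Matrix.mul_assoc]
  simp only [h, ← Finset.sum_mul]
  rw [show ∑ o : ι, creation o * annihilation o = diagonal (fun s : Finset ι => (s.card : ℂ)) from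
    totalNumberOp_eq_diagonal (ι := ι), diagonal_card_mul_numberProj]
  congr 1
  push_cast
  ring

/-- **Frame identity for removing a particle**: `Σ_o c_o P_{N+1} c†_o = (|ι| − N) P_N`. [folklore] -/
theorem sum_annihilation_mul_numberProj_succ_mul_conjTranspose (N : ℕ) :
    ∑ o : ι, annihilation o * diagonal (fun s : Finset ι => if s.card = N + 1 then (1 : ℂ) else 0) *
        (annihilation o)ᴴ =
      (((Fintype.card ι : ℝ) - N : ℝ) : ℂ) •
        diagonal (fun s : Finset ι => if s.card = N then (1 : ℂ) else 0) := by
  have h : ∀ o : ι, annihilation o * diagonal (fun s : Finset ι => if s.card = N + 1 then (1 : ℂ) else 0) *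
      (annihilation o)ᴴ =
      annihilation o * creation o * diagonal (fun s : Finset ι => if s.card = N then (1 : ℂ) else 0) := by
    intro o
    rw [annihilation_conjTranspose, Matrix.mul_assoc, numberProj_succ_mul_creation, ← Matrix.mul_assoc]
  simp only [h, ← Finset.sum_mul]
  rw [sum_annihilation_mul_creation_eq_card_smul_one_sub, Matrix.sub_mul, Matrix.smul_mul, Matrix.one_mul,
    diagonal_card_mul_numberProj, ← sub_smul]
  congr 1
  push_cast
  ring

/-- The sector weight is the trace against the particle-number projection:
`Σ_{|s| = N} Re G_{ss} = Re tr (P_N G)`. [folklore] -/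
theorem sum_filter_card_re_eq_re_trace_numberProj_mul (G : Matrix (Finset ι) (Finset ι) ℂ) (N : ℕ) :
    ∑ s ∈ (Finset.univ.filter fun s : Finset ι => s.card = N), (G s s).re =
      ((diagonal (fun s : Finset ι => if s.card = N then (1 : ℂ) else 0) * G).trace).re := by
  rw [Matrix.trace, Complex.re_sum, Finset.sum_filter]
  refine Finset.sum_congr rfl fun s _ => ?_
  simp only [Matrix.diag_apply, diagonal_mul, ite_mul, one_mul, zero_mul]
  split_ifs <;> simp

/-- **Log-Lipschitz continuity of the sector weights (orbit-sum transfer).** For a Hermitian, particle-number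
conserving `K` on the Fock space over `ι` with `‖[K, c†_o]‖, ‖[K, c_o]‖ ≤ r`, `β ≥ 0` and `N < |ι|`, the sector
weights `W(N) = Σ_{|s|=N} Re (e^{−βK})_{ss}` satisfy `(|ι| − N) W(N) ≤ e^{β|ι|r/(|ι|−N)} (N+1) W(N+1)` and
`(N+1) W(N+1) ≤ e^{β|ι|r/(N+1)} (|ι| − N) W(N)` (`orbitSum_transfer_gibbsWeight` with the trial maps `c†_o`,
resp. `c_o`). The `DecidableEq ι` instance is a parameter of the statement. [folklore] -/
theorem sectorWeight_orbitSum_transfer [inst : DecidableEq ι] (K : Matrix (Finset ι) (Finset ι) ℂ)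
    (hK : K.IsHermitian) (hKsec : ∀ s s' : Finset ι, K s s' ≠ 0 → s.card = s'.card) {r β : ℝ} (hβ : 0 ≤ β)
    (hc : ∀ o : ι, ‖K * creation o - creation o * K‖ ≤ r)
    (ha : ∀ o : ι, ‖K * annihilation o - annihilation o * K‖ ≤ r) (N : ℕ) (hN : N < Fintype.card ι) :
    ((Fintype.card ι : ℝ) - N) *
          ∑ s ∈ (Finset.univ.filter fun s : Finset ι => s.card = N), (gibbsWeight β K s s).re ≤
        Real.exp (β * (Fintype.card ι * r) / ((Fintype.card ι : ℝ) - N)) *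
          (((N : ℝ) + 1) *
            ∑ s ∈ (Finset.univ.filter fun s : Finset ι => s.card = N + 1), (gibbsWeight β K s s).re) ∧
      ((N : ℝ) + 1) * ∑ s ∈ (Finset.univ.filter fun s : Finset ι => s.card = N + 1), (gibbsWeight β K s s).re ≤
        Real.exp (β * (Fintype.card ι * r) / ((N : ℝ) + 1)) *
          (((Fintype.card ι : ℝ) - N) *
            ∑ s ∈ (Finset.univ.filter fun s : Finset ι => s.card = N), (gibbsWeight β K s s).re) := by
  -- the statement is parametric in the `DecidableEq ι` instance (on which `‖·‖` and `gibbsWeight` depend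
  -- syntactically); the proof substitutes the canonical `LinearOrder.toDecidableEq` of the CAR lemmas
  have hinst : inst = LinearOrder.toDecidableEq := Subsingleton.elim _ _
  subst hinst
  have ha0 : (0 : ℝ) < (Fintype.card ι : ℝ) - N := by
    have : (N : ℝ) + 1 ≤ Fintype.card ι := by exact_mod_cast hN
    linarith
  have hKN := numberProj_comm_of_card_eq K hKsec
  refine ⟨?_, ?_⟩
  · -- adding a particle: `P = P_N`, `T_o = c†_o`
    have h := orbitSum_transfer_gibbsWeight (O := ι) hK (numberProj_conjTranspose (ι := ι) N)
      (numberProj_mul_self (ι := ι) N) (hKN N) creation ha0 hβ (ρ := Fintype.card ι * r)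
      (sum_creation_conjTranspose_mul_creation_mul_numberProj (ι := ι) N)
      (fun v => re_star_dotProduct_sum_commutator_mulVec_le K creation (fun o => norm_creation_le_one o) hc _)
    rw [sum_creation_mul_numberProj_mul_conjTranspose, Matrix.smul_mul, Matrix.trace_smul, smul_eq_mul,
      Complex.re_ofReal_mul, ← sum_filter_card_re_eq_re_trace_numberProj_mul,
      ← sum_filter_card_re_eq_re_trace_numberProj_mul] at h
    exact h
  · -- removing a particle: `P = P_{N+1}`, `T_o = c_o`
    have ha1 : (0 : ℝ) < (N : ℝ) + 1 := by positivity
    have h := orbitSum_transfer_gibbsWeight (O := ι) hK (numberProj_conjTranspose (ι := ι) (N + 1))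
      (numberProj_mul_self (ι := ι) (N + 1)) (hKN (N + 1)) annihilation ha1 hβ (ρ := Fintype.card ι * r)
      (sum_annihilation_conjTranspose_mul_annihilation_mul_numberProj_succ (ι := ι) N)
      (fun v => re_star_dotProduct_sum_commutator_mulVec_le K annihilation
        (fun o => norm_annihilation_le_one o) ha _)
    rw [sum_annihilation_mul_numberProj_succ_mul_conjTranspose, Matrix.smul_mul, Matrix.trace_smul, smul_eq_mul,
      Complex.re_ofReal_mul, ← sum_filter_card_re_eq_re_trace_numberProj_mul,
      ← sum_filter_card_re_eq_re_trace_numberProj_mul] at h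
    exact h

end CAR

end Literature.MathematicalPhysics.QuantumLattice
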